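import Summits.CriticalPhenomena.Ising3DConformalLimit.Theses.SynchronousCoupling
import Summits.CriticalPhenomena.Ising3DConformalLimit.Theorems.MoebiusLimitExists.Negative.PinnedClusterPoints
import Literature.Probability.LatticeModels.PlusMinusStateGibbs

/-!
# Sketch — crux-ideate stmt-CriticalPhenomena-4658 (`UniformRegularity`), ideator k = 2, round 1

First lemmas of the two idea cards, typed over existing declarations only
(`criticalTwoPoint`, `criticalBeta`, `isingGibbsMeasures`, `IsTranslationInvariantMeasure`, `spinAt`,
`MeasureTheory.condExp`, `MeasurableSpace.comap`). Nothing here is a route item; nothing is proposed.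

* Card `mirror-markov-boundary-response`: the site plane `P_n = {x₀ = n}` separates `0` from `2n e₀`
  (nearest-neighbour Markov property) and is fixed pointwise by the mirror `x₀ ↦ 2n − x₀`, so
  `g(2n) = ‖E[σ₀ | σ_{P_n}]‖²_{L²}` EXACTLY; hence `⟨σ₀ v⟩² ≤ g(2n)` for every plane-measurable `|v| ≤ 1`
  (Bessel) and `g(n) = ⟨E[σ₀|P_n], σ_{n e₀}⟩ ≤ ‖E[σ₀|P_n]‖_{L¹}`; the crux transfers to the single-distance
  L¹ non-degeneracy `‖E[σ₀|P_n]‖₁² ≥ c·g(n)` of the typical-boundary response.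
* Card `bounded-telemetry-harnack`: `G = criticalTwoPoint 3` solves `Δu = V_eff u` off `0` with
  `V_eff := ΔG/G`; if the telemetry `|x|² V_eff` is merely BOUNDED (no limit, no isotropy, no rate —
  strictly less than item 4495 `InverseSquareLaw`), the scale-invariant elliptic Harnack inequality on
  dyadic annuli gives all-scale doubling (item 6150), hence the crux (landed `uniformRegularity_iff_doubling`).
-/

noncomputable section

namespace Summit.CriticalPhenomena.Ising3DConformalLimit.Cruxes.UniformRegularity.IdeatorK2

open scoped BigOperators
open MeasureTheory Literature.Probability.LatticeModels

/-! ## Card A — mirror–Markov boundary response -/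

/-- The σ-algebra generated by the spins on the site plane `P_n = {y : y 0 = n}` of `ℤ³`. -/
@[reducible] def planeSigma (n : ℤ) : MeasurableSpace (SpinConfig (Site 3)) :=
  MeasurableSpace.comap (fun σ : SpinConfig (Site 3) => fun y : {y : Site 3 // y 0 = n} => σ y.1)
    inferInstance

/-- The typical-boundary response `u_n := E_μ[σ₀ | σ_{P_n}]` (a version of the conditional expectation). -/
def boundaryResponse (μ : Measure (SpinConfig (Site 3))) (n : ℤ) : SpinConfig (Site 3) → ℝ :=
  MeasureTheory.condExp (planeSigma n) μ (spinAt (0 : Site 3))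

/-- **Mirror–Markov identity** (first lemma of card A, provable: global Markov property of the unique
critical state across a site plane + invariance under the mirror `x₀ ↦ 2n − x₀`):
`⟨σ₀ σ_{2n e₀}⟩_{β_c} = ∫ (E[σ₀ | σ_{P_n}])² dμ`. -/
def MirrorMarkovIdentity : Prop :=
  ∀ μ ∈ isingGibbsMeasures 3 (criticalBeta 3) 0, IsTranslationInvariantMeasure μ →
    ∀ n : ℕ, 1 ≤ n →
      ∫ σ, (boundaryResponse μ n σ) ^ 2 ∂μ = criticalTwoPoint 3 (Pi.single 0 (2 * (n : ℤ)))

/-- **Bessel–Markov inequality** (corollary, provable): for every plane-measurable statistic `v` with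
`|v| ≤ 1`, `⟨σ₀ v⟩² ≤ ⟨σ₀ σ_{2n e₀}⟩_{β_c}`. With `v = σ_{n e₀}` it is the known `g(n)² ≤ g(2n)`. -/
def BesselMarkov : Prop :=
  ∀ μ ∈ isingGibbsMeasures 3 (criticalBeta 3) 0, IsTranslationInvariantMeasure μ →
    ∀ n : ℕ, 1 ≤ n → ∀ v : SpinConfig (Site 3) → ℝ,
      Measurable[planeSigma n] v → (∀ σ, |v σ| ≤ 1) →
        (∫ σ, spinAt (0 : Site 3) σ * v σ ∂μ) ^ 2 ≤ criticalTwoPoint 3 (Pi.single 0 (2 * (n : ℤ)))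

/-- **The transferred crux C⁺ of card A** (`TypicalBoundaryResponse`): the L¹ norm of the conditional
magnetisation of the origin given a TYPICAL critical plane at distance `n` is at least `√(c·g(n))` —
"the whole plane predicts the far spin better, by a square root, than its nearest spin does". -/
def TypicalBoundaryResponse : Prop :=
  ∃ c : ℝ, 0 < c ∧ ∀ μ ∈ isingGibbsMeasures 3 (criticalBeta 3) 0, IsTranslationInvariantMeasure μ →
    ∀ n : ℕ, 1 ≤ n →
      c * criticalTwoPoint 3 (Pi.single 0 (n : ℤ)) ≤ (∫ σ, |boundaryResponse μ n σ| ∂μ) ^ 2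

/-- Target shape: item 6150 `TwoPointDoubling` (⟺ the crux 4658, landed `uniformRegularity_iff_doubling`). -/
def Doubling : Prop :=
  ∃ κ : ℝ, 0 < κ ∧ ∀ n : ℕ, 1 ≤ n →
    κ * criticalTwoPoint 3 (Pi.single 0 (n : ℤ)) ≤ criticalTwoPoint 3 (Pi.single 0 (2 * (n : ℤ)))

/-- **Card A reduction** (glue, provable once a critical Gibbs measure is exhibited — `exists_plusMeasure_holds`):
`MirrorMarkovIdentity → TypicalBoundaryResponse → Doubling`, by Jensen `(∫|u|)² ≤ ∫ u²`. -/
def CardAReduction : Prop :=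
  MirrorMarkovIdentity → TypicalBoundaryResponse → Doubling

/-! ## Card B — bounded telemetry + annulus Harnack -/

/-- Squared Euclidean norm of a lattice site, as a real. -/
def sqNorm (x : Site 3) : ℝ := ∑ i, ((x i : ℝ)) ^ 2

/-- Six-neighbour lattice Laplacian. -/
def lap (u : Site 3 → ℝ) (x : Site 3) : ℝ :=
  (∑ i : Fin 3, (u (x + Pi.single i 1) + u (x - Pi.single i 1))) - 6 * u x

/-- **The transferred crux C⁺ of card B** (`BoundedTelemetry`): the exact effective potential
`V_eff = ΔG/G` of the critical two-point function is in the scale-invariant Kato class: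
`sup_{x ≠ 0} |x|₂² |ΔG(x)| / G(x) < ∞` (boundedness only; item 4495 asks for a cofinite LIMIT with a Dini rate). -/
def BoundedTelemetry : Prop :=
  ∃ C : ℝ, ∀ x : Site 3, x ≠ 0 →
    sqNorm x * |lap (criticalTwoPoint 3) x| ≤ C * criticalTwoPoint 3 x

/-- **Annulus Harnack for lattice Schrödinger operators with inverse-square potential** (first lemma of
card B; pure analysis on `ℤ³`, Moser iteration on graphs, constants depending on `C` only): a positive
solution of `Δu = V u` on the fat annulus `{n/2 ≤ |x|₂ ≤ 4n}` with `|x|₂²|V| ≤ C` there is comparable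
to itself on the middle annulus `{n ≤ |x|₂ ≤ 2n}`, uniformly in `n`. -/
def AnnulusHarnack : Prop :=
  ∀ C : ℝ, 0 < C → ∃ K : ℝ, 0 < K ∧ ∀ (u V : Site 3 → ℝ) (n : ℕ), 1 ≤ n →
    (∀ x : Site 3, (n : ℝ) / 2 ≤ Real.sqrt (sqNorm x) → Real.sqrt (sqNorm x) ≤ 4 * n →
        0 < u x ∧ lap u x = V x * u x ∧ sqNorm x * |V x| ≤ C) →
    ∀ x y : Site 3, (n : ℝ) ≤ Real.sqrt (sqNorm x) → Real.sqrt (sqNorm x) ≤ 2 * n →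
      (n : ℝ) ≤ Real.sqrt (sqNorm y) → Real.sqrt (sqNorm y) ≤ 2 * n → u x ≤ K * u y

/-- **Card B reduction** (glue, provable: take `u = G > 0`, `V = ΔG/G`, `x = 2n e₀`, `y = n e₀`... both in
the middle annulus of scale `n`): `AnnulusHarnack → BoundedTelemetry → Doubling`. -/
def CardBReduction : Prop :=
  AnnulusHarnack → BoundedTelemetry → Doubling


/-! ## Kernel-checked glue: both transferred cruxes give doubling (hence the crux, by the landed
`uniformRegularity_iff_doubling`) -/

theorem sqNorm_single (m : ℤ) : sqNorm (Pi.single 0 m) = (m : ℝ) ^ 2 := by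
  simp [sqNorm, Fin.sum_univ_three, Pi.single_apply]

theorem sqrt_sqNorm_single_nat (m : ℕ) : Real.sqrt (sqNorm (Pi.single 0 (m : ℤ))) = m := by
  rw [sqNorm_single, Int.cast_natCast, Real.sqrt_sq (Nat.cast_nonneg m)]

theorem sqNorm_zero : sqNorm 0 = 0 := by simp [sqNorm]

/-- **Card B glue (proved).** Annulus Harnack + bounded telemetry ⇒ all-scale doubling of the critical
axis two-point function, `κ = K(max C 1)⁻¹`. [folklore] -/
theorem cardBReduction_holds : CardBReduction := by
  intro hH hB
  obtain ⟨C, hC⟩ := hB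
  obtain ⟨K, hK, hKall⟩ := hH (max C 1) (lt_max_of_lt_right one_pos)
  refine ⟨K⁻¹, inv_pos.2 hK, fun n hn => ?_⟩
  have hGpos : ∀ x, 0 < criticalTwoPoint 3 x :=
    Summit.CriticalPhenomena.Ising3DConformalLimit.PinnedClusterPoints.criticalTwoPoint_pos3
  have hn1 : (1 : ℝ) ≤ n := by exact_mod_cast hn
  -- the hypotheses of Harnack on the fat annulus hold for u = G, V = ΔG/G
  have hyp : ∀ x : Site 3, (n : ℝ) / 2 ≤ Real.sqrt (sqNorm x) → Real.sqrt (sqNorm x) ≤ 4 * n →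
      0 < criticalTwoPoint 3 x ∧
        lap (criticalTwoPoint 3) x =
          (fun x => lap (criticalTwoPoint 3) x / criticalTwoPoint 3 x) x * criticalTwoPoint 3 x ∧
        sqNorm x * |(fun x => lap (criticalTwoPoint 3) x / criticalTwoPoint 3 x) x| ≤ max C 1 := by
    intro x hlo _
    have hx0 : x ≠ 0 := by
      rintro rfl
      rw [sqNorm_zero, Real.sqrt_zero] at hlo
      linarith
    refine ⟨hGpos x, (div_mul_cancel₀ _ (hGpos x).ne').symm, ?_⟩
    have h1 : sqNorm x * |lap (criticalTwoPoint 3) x / criticalTwoPoint 3 x| =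
        sqNorm x * |lap (criticalTwoPoint 3) x| / criticalTwoPoint 3 x := by
      rw [abs_div, abs_of_pos (hGpos x), mul_div_assoc]
    rw [h1, div_le_iff₀ (hGpos x)]
    calc sqNorm x * |lap (criticalTwoPoint 3) x| ≤ C * criticalTwoPoint 3 x := hC x hx0
      _ ≤ max C 1 * criticalTwoPoint 3 x :=
          mul_le_mul_of_nonneg_right (le_max_left _ _) (hGpos x).le
  have key := hKall (criticalTwoPoint 3) (fun x => lap (criticalTwoPoint 3) x / criticalTwoPoint 3 x)
    n hn hyp (Pi.single 0 (n : ℤ)) (Pi.single 0 (2 * (n : ℤ)))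
    (by rw [sqrt_sqNorm_single_nat]) (by rw [sqrt_sqNorm_single_nat]; linarith)
    (by rw [show (2 * (n : ℤ)) = ((2 * n : ℕ) : ℤ) by push_cast; ring, sqrt_sqNorm_single_nat]
        push_cast; linarith)
    (by rw [show (2 * (n : ℤ)) = ((2 * n : ℕ) : ℤ) by push_cast; ring, sqrt_sqNorm_single_nat]
        push_cast; linarith)
  -- G(n e₀) ≤ K · G(2n e₀)
  rw [inv_mul_le_iff₀ hK]
  exact key

/-- **Card A glue (proved).** Mirror–Markov identity + L¹ non-degeneracy of the typical-boundary response
⇒ all-scale doubling, by Jensen `(∫|u|)² ≤ ∫u²` in the (unique) critical Gibbs state. [folklore] -/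
theorem cardAReduction_holds : CardAReduction := by
  intro hM hT
  obtain ⟨c, hc, hcall⟩ := hT
  obtain ⟨μ, hμG, hμT, -⟩ :=
    exists_plusMeasure_holds (d := 3) (β := criticalBeta 3) (h := 0) (criticalBeta_nonneg (d := 3))
  refine ⟨c, hc, fun n hn => ?_⟩
  have h1 := hcall μ hμG hμT n hn
  have h2 := hM μ hμG hμT n hn
  have hG : IsGibbsMeasure (isingSpecification (zdGraph 3) (criticalBeta 3) 0) μ := hμG
  haveI := hG.isProbabilityMeasure
  set u := boundaryResponse μ n with hu
  -- u is integrable and a.e. bounded by 1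
  have hui : Integrable u μ := integrable_condExp
  have hbd : ∀ᵐ σ ∂μ, |u σ| ≤ ((1 : NNReal) : ℝ) := by
    refine ae_bdd_condExp_of_ae_bdd (Filter.Eventually.of_forall fun σ => ?_)
    simp only [NNReal.coe_one, spinAt]
    rcases Int.units_eq_one_or (σ 0) with h | h <;> simp [h]
  have hu2 : Integrable (fun σ => u σ ^ 2) μ := by
    refine (hui.abs).mono' (hui.aestronglyMeasurable.pow 2) ?_
    filter_upwards [hbd] with σ hσ
    rw [Real.norm_eq_abs, abs_pow, pow_two]
    simp only [NNReal.coe_one] at hσ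
    exact mul_le_of_le_one_left (abs_nonneg _) hσ
  -- Jensen via 0 ≤ ∫ (|u| - m)²
  set m := ∫ σ, |u σ| ∂μ with hm
  have hJ : m ^ 2 ≤ ∫ σ, u σ ^ 2 ∂μ := by
    have hexp : ∀ σ, (|u σ| - m) ^ 2 = u σ ^ 2 - 2 * m * |u σ| + m ^ 2 := by
      intro σ; rw [sub_sq, sq_abs]; ring
    have hnn : 0 ≤ ∫ σ, (|u σ| - m) ^ 2 ∂μ := integral_nonneg fun σ => sq_nonneg _
    have hcalc : ∫ σ, (|u σ| - m) ^ 2 ∂μ = (∫ σ, u σ ^ 2 ∂μ) - 2 * m * m + m ^ 2 := by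
      simp_rw [hexp]
      rw [integral_add, integral_sub hu2 (hui.abs.const_mul _), integral_const_mul, integral_const]
      · simp [hm]
      · exact hu2.sub (hui.abs.const_mul _)
      · exact integrable_const _
    nlinarith [hnn, hcalc]
  calc c * criticalTwoPoint 3 (Pi.single 0 (n : ℤ)) ≤ m ^ 2 := h1
    _ ≤ ∫ σ, u σ ^ 2 ∂μ := hJ
    _ = criticalTwoPoint 3 (Pi.single 0 (2 * (n : ℤ))) := h2

end Summit.CriticalPhenomena.Ising3DConformalLimit.Cruxes.UniformRegularity.IdeatorK2

end
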